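import Summits.Ventures.YMGap.RobustBall.FreeEnergyLaw
import Literature.MathematicalPhysics.QuantumFieldTheory.WilsonPlaquetteWeakCouplingFloor
import HarnessLib

/-!
# Robust ball (Y2), area-law side — THE INTERNAL-ENERGY LAW and THE TORUS MEAN-PLAQUETTE LAW (eventually in the volume)

HONEST FRAMING: venture file of the cell `pub-ymgap` (QuantumFields programme), track ROBUST-BALL, seat rb-p2 (g7).  LATTICE
statements, Wilson action, `G ≅ SU(N)`; sequel of `FreeEnergyLaw.lean`.  WHAT IS NEW:
* ★★ `deriv_freeEnergyDensity_two_sided` — THE INTERNAL-ENERGY LAW: at every coupling `s ≥ 0` where the (convex) free energy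
  density `f` is differentiable — all but countably many, `exists_countable_deriv_freeEnergyDensity_two_sided` — its derivative
  (`= −lim_L |Λ_L|⁻¹⟨S_W⟩_{Λ_L,s}`, Griffiths' lemma, tree `tendsto_wilsonActionDensity_of_differentiableAt`) obeys
  `#planes · V₀ s e^{−2(d−1)(2d+1)Ns} ≤ f'(s) + #planes·N ≤ #planes · V₀ s e^{8(d−1)²Ns}`; `SU(2)`, `d = 4`:
  `3β_W e^{−54β_W} ≤ f'(β_W/2) + 12 ≤ 3β_W e^{72β_W}` (`su2_deriv_freeEnergy_two_sided_dim4`), i.e. the thermodynamic mean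
  plaquette `lim_L ⟨(1/2) Re tr U_p⟩_{Λ_L} = (f'(β_W/2) + 12)/12` is `(β_W/4) e^{[−54β_W, 72β_W]}`;
* ★★ `eventually_torusPlaquette_two_sided` — THE TORUS MEAN-PLAQUETTE LAW, eventually in the volume: for every `s ≥ 0` and
  `ε > 0`, for all large `L`, EVERY plaquette of the torus `(ℤ/(L+1)ℤ)^d` has
  `V₀ s e^{−2(d−1)(2d+1)Ns} − ε ≤ ⟨Re tr ρ(U_{x,ij})⟩_{Λ_{L+1}, s} ≤ V₀ s e^{8(d−1)²Ns} + ε` (rb-p2 g6's limit-state law pulled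
  back to large tori by compactness, `FreeEnergyLaw.eventually_planeSum_le`; all torus plaquettes are equal in law, tree
  `wilsonExpectation_plaquetteCost_eq`).
WHAT IT IS NOT: no rate in `L`; no differentiability of `f` is claimed at any prescribed coupling (convexity gives it off a
countable set; analyticity at strong coupling is Osterwalder–Seiler, tree `exists_gateauxAnalytic_wilsonPressure`, not used);
nothing continuum / spectral / Clay.  0 compute.

References: S. Friedli, Y. Velenik, *Statistical Mechanics of Lattice Systems* (2017), Thm. B.12 and Cor. 3.7 (Griffiths);
I. Montvay, G. Münster, *Quantum Fields on a Lattice* (1994) §3.2 (internal energy = mean plaquette).  Everything here is proved.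
[folklore]
-/

noncomputable section

open MeasureTheory Filter Topology Finset
open Literature.MathematicalPhysics.QuantumLattice
open Literature.MathematicalPhysics.QuantumFieldTheory hiding ZdEdge

namespace Summit.Ventures.YMGap.RobustBall

namespace FreeEnergyLaw

/-! ### The internal-energy law: the coupling derivative of the free energy density -/

section Derivative

variable {d N : ℕ} {G : Type*} [Group G] [TopologicalSpace G] [IsTopologicalGroup G]
  [CompactSpace G] [MeasurableSpace G] [BorelSpace G] [SecondCountableTopology G] [T2Space G]
  (ρ : G →* Matrix (Fin N) (Fin N) ℂ)

omit [T2Space G] in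
/-- The torus energy density per site is `#planes·N` minus the plane sum of plaquette expectations:
`|Λ_{L+1}|⁻¹ ⟨S_W⟩_{Λ_{L+1}, s} = #planes·N − ∑_{i<j} ⟨Re tr ρ(U_{(0,i,j)})⟩_{Λ_{L+1}, s}`. [folklore] -/
theorem wilsonActionDensity_eq (hρ : Continuous ρ) (s : ℝ) (L : ℕ) :
    (((L + 1 : ℕ) : ℝ) ^ d)⁻¹ * wilsonExpectation (L := L + 1) ρ s (wilsonAction (d := d) (L := L + 1) (G := G) ρ) =
      (Fintype.card {q : Fin d × Fin d // q.1 < q.2} : ℝ) * N -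
        ∑ q : {q : Fin d × Fin d // q.1 < q.2},
          wilsonExpectation (L := L + 1) ρ s
            (toTorusObservable (L + 1) (plaquetteObs ρ (0 : Literature.Probability.LatticeModels.Site d) q.1.1 q.1.2)) := by
  have h := wilsonExpectation_neg_wilsonAction (d := d) ρ hρ s (L + 1)
  have hcard : (Fintype.card (Site d (L + 1)) : ℝ) = ((L + 1 : ℕ) : ℝ) ^ d := by
    rw [Fintype.card_fun, ZMod.card, Fintype.card_fin]; push_cast; ring
  have hneg : wilsonExpectation (L := L + 1) ρ s (fun U : GaugeConfig d (L + 1) G => -wilsonAction ρ U) =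
      -wilsonExpectation (L := L + 1) ρ s (wilsonAction (d := d) (L := L + 1) (G := G) ρ) := by
    unfold wilsonExpectation; exact integral_neg _
  rw [hneg, hcard] at h
  have hpow : (((L + 1 : ℕ) : ℝ) ^ d) ≠ 0 := by positivity
  have h' : wilsonExpectation (L := L + 1) ρ s (wilsonAction (d := d) (L := L + 1) (G := G) ρ) =
      ((L + 1 : ℕ) : ℝ) ^ d * ((Fintype.card {q : Fin d × Fin d // q.1 < q.2} : ℝ) * N -
        ∑ q : {q : Fin d × Fin d // q.1 < q.2},
          wilsonExpectation (L := L + 1) ρ s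
            (toTorusObservable (L + 1) (plaquetteObs ρ (0 : Literature.Probability.LatticeModels.Site d) q.1.1 q.1.2))) := by
    linarith
  rw [h', ← mul_assoc, inv_mul_cancel₀ hpow, one_mul]

/-- ★★ **THE INTERNAL-ENERGY LAW.**  For `G ≅ SU(N)`, `N ≥ 2`, `d ≥ 2`, at every coupling `s ≥ 0` at which the (convex) free
energy density is differentiable — all but countably many — its derivative, i.e. minus the thermodynamic limit of the Wilson
action density (tree `tendsto_wilsonActionDensity_of_differentiableAt`, Griffiths' lemma), obeys
`#planes · V₀ s e^{−2(d−1)(2d+1)Ns} ≤ f'(s) + #planes·N ≤ #planes · V₀ s e^{8(d−1)²Ns}`: the thermodynamic mean plaquette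
`(f'(s) + #planes·N)/#planes` carries the exact leading strong-coupling coefficient `V₀ s` (`= N u`). [folklore] -/
theorem deriv_freeEnergyDensity_two_sided (hρ : IsSpecialUnitaryModel ρ) (hN : 2 ≤ N) (hd : 2 ≤ d) {s : ℝ} (hs : 0 ≤ s)
    (hdiff : DifferentiableAt ℝ (freeEnergyDensity d ρ) s) :
    (Fintype.card {q : Fin d × Fin d // q.1 < q.2} : ℝ) *
        (PlaquetteLowerBound.charVariance ρ * s * Real.exp (-(2 * ((d : ℝ) - 1) * (2 * (d : ℝ) + 1) * N * s))) ≤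
      deriv (freeEnergyDensity d ρ) s + (Fintype.card {q : Fin d × Fin d // q.1 < q.2} : ℝ) * N ∧
    deriv (freeEnergyDensity d ρ) s + (Fintype.card {q : Fin d × Fin d // q.1 < q.2} : ℝ) * N ≤
      (Fintype.card {q : Fin d × Fin d // q.1 < q.2} : ℝ) *
        (PlaquetteLowerBound.charVariance ρ * s * Real.exp (8 * ((d : ℝ) - 1) ^ 2 * N * s)) := by
  haveI : NeZero d := ⟨by omega⟩
  set D : ℝ := (Fintype.card {q : Fin d × Fin d // q.1 < q.2} : ℝ) with hDdef
  -- the plane sums converge to `f'(s) + D N`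
  have hlim0 := tendsto_wilsonActionDensity_of_differentiableAt (d := d) ρ hρ.1 hdiff
  have hlim : Tendsto (fun L : ℕ => ∑ q : {q : Fin d × Fin d // q.1 < q.2},
      wilsonExpectation (L := L + 1) ρ s
        (toTorusObservable (L + 1) (plaquetteObs ρ (0 : Literature.Probability.LatticeModels.Site d) q.1.1 q.1.2)))
      atTop (𝓝 (deriv (freeEnergyDensity d ρ) s + D * N)) := by
    have h := (hlim0.const_sub (D * N))
    refine (h.congr fun L => ?_).trans (by rw [show D * N - -deriv (freeEnergyDensity d ρ) s =
      deriv (freeEnergyDensity d ρ) s + D * N by ring])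
    rw [wilsonActionDensity_eq (d := d) ρ hρ.1 s L]
    ring
  constructor
  · refine le_of_forall_pos_lt_add fun ε hε => ?_
    have hev := eventually_le_planeSum (d := d) ρ hρ.1 (s := s) (ε := ε / 2)
      (B := D * (PlaquetteLowerBound.charVariance ρ * s * Real.exp (-(2 * ((d : ℝ) - 1) * (2 * (d : ℝ) + 1) * N * s))))
      (fun μ hμ => (planeSum_limitState_two_sided (d := d) ρ hρ hN hd hs hμ).1) (half_pos hε)
    have h := ge_of_tendsto hlim hev
    linarith
  · refine le_of_forall_pos_lt_add fun ε hε => ?_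
    have hev := eventually_planeSum_le (d := d) ρ hρ.1 (s := s) (ε := ε / 2)
      (B := D * (PlaquetteLowerBound.charVariance ρ * s * Real.exp (8 * ((d : ℝ) - 1) ^ 2 * N * s)))
      (fun μ hμ => (planeSum_limitState_two_sided (d := d) ρ hρ hN hd hs hμ).2) (half_pos hε)
    have h := le_of_tendsto hlim hev
    linarith

/-- ★ **The internal-energy law holds off a countable set of couplings** (the free energy density is convex, tree
`convexOn_freeEnergyDensity`, hence differentiable off a countable set). [folklore] -/
theorem exists_countable_deriv_freeEnergyDensity_two_sided (hρ : IsSpecialUnitaryModel ρ) (hN : 2 ≤ N) (hd : 2 ≤ d) :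
    ∃ S : Set ℝ, S.Countable ∧ ∀ s ∉ S, 0 ≤ s →
      (Fintype.card {q : Fin d × Fin d // q.1 < q.2} : ℝ) *
          (PlaquetteLowerBound.charVariance ρ * s * Real.exp (-(2 * ((d : ℝ) - 1) * (2 * (d : ℝ) + 1) * N * s))) ≤
        deriv (freeEnergyDensity d ρ) s + (Fintype.card {q : Fin d × Fin d // q.1 < q.2} : ℝ) * N ∧
      deriv (freeEnergyDensity d ρ) s + (Fintype.card {q : Fin d × Fin d // q.1 < q.2} : ℝ) * N ≤
        (Fintype.card {q : Fin d × Fin d // q.1 < q.2} : ℝ) *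
          (PlaquetteLowerBound.charVariance ρ * s * Real.exp (8 * ((d : ℝ) - 1) ^ 2 * N * s)) :=
  ⟨{s | ¬ DifferentiableAt ℝ (freeEnergyDensity d ρ) s},
    Balaban1983to89.Missing.countable_not_differentiableAt_of_convexOn_univ (convexOn_freeEnergyDensity ρ hρ.1),
    fun _ hs hs0 => deriv_freeEnergyDensity_two_sided (d := d) ρ hρ hN hd hs0 (by simpa using hs)⟩

/-- ★★ **SU(2), `d = 4`, THE INTERNAL-ENERGY LAW**: at every `β_W ≥ 0` at which `f` is differentiable at `β_W/2` (all but
countably many), `3β_W e^{−54β_W} ≤ f'(β_W/2) + 12 ≤ 3β_W e^{72β_W}`; i.e. the thermodynamic mean plaquette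
`(f'(β_W/2) + 12)/12 = lim_L ⟨(1/2) Re tr U_p⟩_{Λ_L}` is `(β_W/4)·e^{[−54β_W, 72β_W]}`. [folklore] -/
theorem su2_deriv_freeEnergy_two_sided_dim4 {βW : ℝ} (hβ : 0 ≤ βW)
    (hdiff : DifferentiableAt ℝ (freeEnergyDensity 4 (fundamentalRep (Fin 2))) (βW / 2)) :
    3 * βW * Real.exp (-(54 * βW)) ≤ deriv (freeEnergyDensity 4 (fundamentalRep (Fin 2))) (βW / 2) + 12 ∧
      deriv (freeEnergyDensity 4 (fundamentalRep (Fin 2))) (βW / 2) + 12 ≤ 3 * βW * Real.exp (72 * βW) := by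
  have hρ := TorusAreaLaw.isSpecialUnitaryModel_fundamentalRep 2
  have h := deriv_freeEnergyDensity_two_sided (d := 4) (fundamentalRep (Fin 2)) hρ le_rfl (by norm_num)
    (by positivity : (0 : ℝ) ≤ βW / 2) hdiff
  have hD : (Fintype.card {q : Fin 4 × Fin 4 // q.1 < q.2} : ℝ) = 6 := by
    rw [show Fintype.card {q : Fin 4 × Fin 4 // q.1 < q.2} = 6 by rfl]; norm_num
  rw [HaarSecondMoments.charVariance_su2, hD] at h
  push_cast at h
  obtain ⟨h1, h2⟩ := h
  constructor
  · have e1 : 3 * βW * Real.exp (-(54 * βW)) =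
        6 * (1 * (βW / 2) * Real.exp (-(2 * ((4 : ℝ) - 1) * (2 * (4 : ℝ) + 1) * 2 * (βW / 2)))) := by ring_nf
    have e2 : deriv (freeEnergyDensity 4 (fundamentalRep (Fin 2))) (βW / 2) + 6 * 2 =
        deriv (freeEnergyDensity 4 (fundamentalRep (Fin 2))) (βW / 2) + 12 := by norm_num
    rw [e1, ← e2]; exact h1
  · have e1 : 3 * βW * Real.exp (72 * βW) = 6 * (1 * (βW / 2) * Real.exp (8 * ((4 : ℝ) - 1) ^ 2 * 2 * (βW / 2))) := by
      ring_nf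
    have e2 : deriv (freeEnergyDensity 4 (fundamentalRep (Fin 2))) (βW / 2) + 6 * 2 =
        deriv (freeEnergyDensity 4 (fundamentalRep (Fin 2))) (βW / 2) + 12 := by norm_num
    rw [e1, ← e2]; exact h2

end Derivative

/-! ### The torus mean-plaquette law, eventually in the volume -/

section TorusPlaquette

variable {d N : ℕ} {G : Type*} [Group G] [TopologicalSpace G] [IsTopologicalGroup G]
  [CompactSpace G] [MeasurableSpace G] [BorelSpace G] [SecondCountableTopology G] [T2Space G]
  (ρ : G →* Matrix (Fin N) (Fin N) ℂ)

omit [T2Space G] in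
/-- On the torus every plaquette has the same expectation, so each equals the plane-sum average:
`⟨Re tr ρ(U_{x,ij})⟩_{Λ_{L+1}, s} = (#planes)⁻¹ ∑_{i'<j'} ⟨Re tr ρ(U_{(0,i',j')})⟩_{Λ_{L+1}, s}` (tree
`wilsonExpectation_plaquetteCost_eq`: translations and axis permutations). [folklore] -/
theorem wilsonExpectation_plaquette_eq_planeSum_div (hρ : Continuous ρ) (hd : 2 ≤ d) (s : ℝ) (L : ℕ) (x : Site d (L + 1))
    {i j : Fin d} (hij : i ≠ j) :
    wilsonExpectation (L := L + 1) ρ s (fun U : GaugeConfig d (L + 1) G => (ρ (plaquetteHolonomy U x i j)).trace.re) =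
      (∑ q : {q : Fin d × Fin d // q.1 < q.2},
          wilsonExpectation (L := L + 1) ρ s
            (toTorusObservable (L + 1) (plaquetteObs ρ (0 : Literature.Probability.LatticeModels.Site d) q.1.1 q.1.2))) /
        (Fintype.card {q : Fin d × Fin d // q.1 < q.2} : ℝ) := by
  haveI := isProbabilityMeasure_wilsonMeasure (d := d) (L := L + 1) ρ hρ s
  -- each plane term equals the `(x, i, j)` term
  have hcost : ∀ q : {q : Fin d × Fin d // q.1 < q.2},
      wilsonExpectation (L := L + 1) ρ s
          (toTorusObservable (L + 1) (plaquetteObs ρ (0 : Literature.Probability.LatticeModels.Site d) q.1.1 q.1.2)) =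
        wilsonExpectation (L := L + 1) ρ s (fun U : GaugeConfig d (L + 1) G => (ρ (plaquetteHolonomy U x i j)).trace.re) := by
    intro q
    have h := wilsonExpectation_plaquetteCost_eq (d := d) (L := L + 1) ρ hρ s (x := (0 : Site d (L + 1))) (x' := x)
      (ne_of_lt q.2) hij
    have hint : ∀ (y : Site d (L + 1)) (a b : Fin d), Integrable
        (fun U : GaugeConfig d (L + 1) G => (ρ (plaquetteHolonomy U y a b)).trace.re) (wilsonMeasure (d := d) (L := L + 1) ρ s) := by
      intro y a b
      have hc : Continuous fun U : GaugeConfig d (L + 1) G => (ρ (plaquetteHolonomy U y a b)).trace.re := by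
        have h := continuous_toTorusObservable_plaquetteObs ρ hρ (L + 1) a b
        have hsh : Continuous fun U : GaugeConfig d (L + 1) G => torusConfigShift (-y) U :=
          continuous_pi fun e => by simp only [torusConfigShift_apply]; exact continuous_apply _
        refine (h.comp hsh).congr fun U => ?_
        exact (plaquette_eq_toTorusObservable_shift ρ (L + 1) y a b U).symm
      exact hc.integrable_of_hasCompactSupport (HasCompactSupport.of_compactSpace _)
    have hsub : ∀ (y : Site d (L + 1)) (a b : Fin d),
        wilsonExpectation (L := L + 1) ρ s (fun U : GaugeConfig d (L + 1) G => (N : ℝ) - (ρ (plaquetteHolonomy U y a b)).trace.re) =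
          N - wilsonExpectation (L := L + 1) ρ s (fun U : GaugeConfig d (L + 1) G => (ρ (plaquetteHolonomy U y a b)).trace.re) := by
      intro y a b
      unfold wilsonExpectation
      rw [integral_sub (integrable_const _) (hint y a b), integral_const, smul_eq_mul, probReal_univ, one_mul]
    rw [hsub, hsub] at h
    have h0 : wilsonExpectation (L := L + 1) ρ s
        (toTorusObservable (L + 1) (plaquetteObs ρ (0 : Literature.Probability.LatticeModels.Site d) q.1.1 q.1.2)) =
        wilsonExpectation (L := L + 1) ρ s (fun U : GaugeConfig d (L + 1) G => (ρ (plaquetteHolonomy U 0 q.1.1 q.1.2)).trace.re) := by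
      congr 1; funext U; exact toTorusObservable_plaquetteObs_zero ρ (L + 1) q.1.1 q.1.2 U
    rw [h0]; linarith
  rw [Finset.sum_congr rfl fun q _ => hcost q, Finset.sum_const, Finset.card_univ, nsmul_eq_mul]
  have hD : (0 : ℝ) < (Fintype.card {q : Fin d × Fin d // q.1 < q.2} : ℝ) := by
    have h01 : (⟨0, by omega⟩ : Fin d) < ⟨1, by omega⟩ := Fin.mk_lt_mk.2 (by norm_num)
    have : 0 < Fintype.card {q : Fin d × Fin d // q.1 < q.2} :=
      Fintype.card_pos_iff.2 ⟨⟨(⟨0, by omega⟩, ⟨1, by omega⟩), h01⟩⟩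
    exact_mod_cast this
  field_simp

/-- ★★ **THE TORUS MEAN-PLAQUETTE LAW, eventually in the volume.**  For `G ≅ SU(N)`, `N ≥ 2`, `d ≥ 2`, every `s ≥ 0` and every
`ε > 0` there is `L₀` such that for all `L ≥ L₀`, every site `x` and all axes `i ≠ j` of the torus `(ℤ/(L+1)ℤ)^d`,
`V₀ s e^{−2(d−1)(2d+1)Ns} − ε ≤ ⟨Re tr ρ(U_{x,ij})⟩_{Λ_{L+1}, s} ≤ V₀ s e^{8(d−1)²Ns} + ε` (rb-p2 g6's limit-state law pulled back to
large tori by compactness). [folklore] -/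
theorem eventually_torusPlaquette_two_sided (hρ : IsSpecialUnitaryModel ρ) (hN : 2 ≤ N) (hd : 2 ≤ d) {s : ℝ} (hs : 0 ≤ s)
    {ε : ℝ} (hε : 0 < ε) :
    ∀ᶠ L : ℕ in atTop, ∀ (x : Site d (L + 1)) (i j : Fin d), i ≠ j →
      PlaquetteLowerBound.charVariance ρ * s * Real.exp (-(2 * ((d : ℝ) - 1) * (2 * (d : ℝ) + 1) * N * s)) - ε ≤
          wilsonExpectation (L := L + 1) ρ s (fun U : GaugeConfig d (L + 1) G => (ρ (plaquetteHolonomy U x i j)).trace.re) ∧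
        wilsonExpectation (L := L + 1) ρ s (fun U : GaugeConfig d (L + 1) G => (ρ (plaquetteHolonomy U x i j)).trace.re) ≤
          PlaquetteLowerBound.charVariance ρ * s * Real.exp (8 * ((d : ℝ) - 1) ^ 2 * N * s) + ε := by
  haveI : NeZero d := ⟨by omega⟩
  set D : ℝ := (Fintype.card {q : Fin d × Fin d // q.1 < q.2} : ℝ) with hDdef
  have hD : 0 < D := by
    have h01 : (⟨0, by omega⟩ : Fin d) < ⟨1, by omega⟩ := Fin.mk_lt_mk.2 (by norm_num)
    have : 0 < Fintype.card {q : Fin d × Fin d // q.1 < q.2} :=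
      Fintype.card_pos_iff.2 ⟨⟨(⟨0, by omega⟩, ⟨1, by omega⟩), h01⟩⟩
    rw [hDdef]; exact_mod_cast this
  have hlow := eventually_le_planeSum (d := d) ρ hρ.1 (s := s) (ε := D * ε)
    (B := D * (PlaquetteLowerBound.charVariance ρ * s * Real.exp (-(2 * ((d : ℝ) - 1) * (2 * (d : ℝ) + 1) * N * s))))
    (fun μ hμ => (planeSum_limitState_two_sided (d := d) ρ hρ hN hd hs hμ).1) (mul_pos hD hε)
  have hup := eventually_planeSum_le (d := d) ρ hρ.1 (s := s) (ε := D * ε)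
    (B := D * (PlaquetteLowerBound.charVariance ρ * s * Real.exp (8 * ((d : ℝ) - 1) ^ 2 * N * s)))
    (fun μ hμ => (planeSum_limitState_two_sided (d := d) ρ hρ hN hd hs hμ).2) (mul_pos hD hε)
  filter_upwards [hlow, hup] with L hL hU x i j hij
  rw [wilsonExpectation_plaquette_eq_planeSum_div (d := d) ρ hρ.1 hd s L x hij]
  constructor
  · rw [le_div_iff₀ hD]
    calc (PlaquetteLowerBound.charVariance ρ * s * Real.exp (-(2 * ((d : ℝ) - 1) * (2 * (d : ℝ) + 1) * N * s)) - ε) * D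
        = D * (PlaquetteLowerBound.charVariance ρ * s * Real.exp (-(2 * ((d : ℝ) - 1) * (2 * (d : ℝ) + 1) * N * s))) - D * ε := by
          ring
      _ ≤ _ := hL
  · rw [div_le_iff₀ hD]
    calc _ ≤ D * (PlaquetteLowerBound.charVariance ρ * s * Real.exp (8 * ((d : ℝ) - 1) ^ 2 * N * s)) + D * ε := hU
      _ = (PlaquetteLowerBound.charVariance ρ * s * Real.exp (8 * ((d : ℝ) - 1) ^ 2 * N * s) + ε) * D := by ring

end TorusPlaquette

end FreeEnergyLaw

end Summit.Ventures.YMGap.RobustBall
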